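import Literature.AnabelianGeometry.EtaleTheta.Discharge.Sec5Prop52iiiRootKummerOfBiKummerData
import Literature.AnabelianGeometry.EtaleTheta.Discharge.Sec5OfConnectedTemperoid

/-!
# [EtTh] Prop. 5.2 (iii) at the GENUINE §5 data over `B^temp(Π^tp_X)⁰`, Frobenioid half: the Kummer cocycle of the root function
# `f_N|_{B_N}` IS the bi-Kummer difference; (iii) ⟺ a clause on the root function alone (pp. 317, 324, 331 / PDF pp. 91, 98, 105) — FILE 2 of 2

Mochizuki, *The étale theta function and its Frobenioid-theoretic manifestations*, Publ. RIMS **45** (2009) [MochizukiEtTh2009], Prop. 4.3 (iii)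
p.317 (PDF p.91) («… equal to the Kummer class … `κ_{f|_{B_N}}`»), Prop. 5.2 (i)/(iii) p.324 (PDF p.98) («These assertions follow immediately from
the definitions»), §5 p.331 (PDF p.105).  [cite: MochizukiEtTh2009, Prop 4.3 (iii) p.317 (PDF p.91); Prop 5.2 (iii) p.324 (PDF p.98); §5 p.331 (PDF p.105)]

abc-iut cell, layer L2, seat abc-iut-L2-t4 (gen 5; §5 owner lineage, W3-L2-01), abc-iut-L2-lead (gen 4) row R353 **R-C3 «Prop 5.2 (iii) AT
ofConnectedTemperoidData»** (abc-iut-L2-d4's Thm 5.7 residual (C3)).  PROOF-ONLY (0 `def`s; nothing landed edited or restated).  Sequel of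
`Discharge/Sec5Prop52iiiRootKummerOfBiKummerData.lean` (FILE 1: the identity for the ASSEMBLED data in dictionary form), read at my genuine data
`ThetaFrobenioid.ofConnectedTemperoidData` (`Discharge/Sec5OfConnectedTemperoid.lean`: `toB = id`, dictionary laws = abc-iut-L2-t9's model formulas
`coe_fracOfModel_mul_unit` / `coe_biratAutModel_eq_pull` / `coe_restrictAlongModel_apply`, section property = `baseMap_strvOfBiKummerData`):
* `biratAutModel_sgpCap_restrict_ofConnectedTemperoidData` — **`s^⊓-gp_N(ρ y)·g_B = u_{ω_y}·g_B`** for `y ∈ Π^tp_Ÿ`, `g_B := f_N|_{B_N}`,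
  `ω_y := s^⊔-gp_N(ρ y)·s^⊓-gp_N(ρ y)⁻¹` — Prop. 4.3 (iii) clause 2 / Prop. 5.2 (iii) Frobenioid half, UNCONDITIONAL given the [FrdI] Thm. 5.2
  hypotheses `h` of the data (no `hH`, no `H : Facts`);
* `unit_diffCocycle_mul_restrict_ofConnectedTemperoidData` — the same with `ω_y` packaged as abc-iut-L2-t11's `diffCocycle H y`;
* `eq_sgpCup_mul_sgpCap_inv_of_mul_restrict_ofConnectedTemperoidData` — UNIQUENESS: the root function DETERMINES the bi-Kummer difference;
* `thetaSectionCompat_iff_rootKummer_ofConnectedTemperoidData` — **Prop. 5.2 (iii) (F-0521 `ThetaSectionCompat`) AT THE GENUINE DATA ⟺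
  «`∀ k ∈ Π^tp_Ÿ`, `s^⊓-gp_N(ρ k)·g_B = u_{m⁻¹(η(ι k))⁻¹}·g_B`»**, a clause on the ROOT FUNCTION ALONE — print's (β) «`f_N` is [the
  Frobenioid-theoretic version of] a root of `Θ̈`, whose Kummer class is `η̲̈^Θ` mod `N`» in Kummer currency.  (At the Setting
  `ofThetaSettingData` this is an instance by `ofThetaSettingData_eq`, with `(T := C.thetaEnvData μ hC hS)`, `(ιX := refl)`.)
HONEST RESIDUAL (unchanged, now in function currency): whether that clause holds with `η ∈ thetaCocycles` — the junction «`θ := Θ̈`» (GAP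
G-L2t4-2), provable exactly when a geometric `tf` supplies `Θ̈ ∈ B(Ÿ̲̲)` with Prop. 1.3's class (FOUNDATIONS rows 13–14; §1 side abc-iut-L2-t12's
`ThetaKummerInput.kummerTheta` / `IsThetaKummer`).  `m` is generic («via Prop 5.5»: a consumer may take the Prop. 5.5 identification).
Kernel-checked consequences for data so typed; nothing asserts these data exist for an actual curve; no side is taken on [IUTchIII] Cor. 3.12;
typed ≠ proved for every named input.
-/

noncomputable section

namespace Literature.AnabelianGeometry.EtaleTheta

open CategoryTheory Opposite Literature.AlgebraicGeometry.Frobenioids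

universe u₀ v₀ w

namespace ThetaFrobenioid

/-! ## The GENUINE connected data over `B^temp(Π^tp_X)⁰` (`toB = id`, laws discharged) -/

section Genuine

open Literature.AnabelianGeometry.SemiGraphs Literature.AlgebraicGeometry.Frobenioids.QuasiTemperoid.BTempConnected

variable {K : Type u₀} [Field K] {X : SemiGraphs.TemperedArithmeticGroup.{u₀} K} {D₀ : Type u₀} [Category.{v₀} D₀]
  {V : FrdIMonoidStub.{w}} {T₀ : RealifiedDivisorMonoids (D₀ := D₀) V}
  {VD : FrdICatStub.{u₀ + 1, u₀, w} (ConnectedPart (BTemp X.Pi))}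
  {tf : TemperedFrobenioid T₀ (ConnectedPart (BTemp X.Pi)) VD} {hZ : tf.monoidType = MonoidType.Z}
  {hP : ∀ A : (ConnectedPart (BTemp X.Pi))ᵒᵖ, IsPerfect (tf.Φ.carrier A)}
  {NH : Subgroup (Field.absoluteGaloisGroup K) → tf.category → ℕ+ → Prop} {A₀ : tf.category}
  {hA₀ : PreFrobenioid.IsFrobeniusTrivial tf.toElem A₀} {hA₀' : SemiGraphs.IsGaloisObj A₀.base.obj}
  {pullFrac : ∀ {A A' : (BiKummerSetting.mkOfConnectedTemperoid X tf hZ hP NH A₀ hA₀ hA₀').C} (_ : A' ⟶ A),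
    (BiKummerSetting.mkOfConnectedTemperoid X tf hZ hP NH A₀ hA₀ hA₀').biratUnits A →
      (BiKummerSetting.mkOfConnectedTemperoid X tf hZ hP NH A₀ hA₀ hA₀').biratUnits A'}
  {lv N : ℕ+} {T : ThetaEnvData.{max u₀ w} N}
  {θ : (BiKummerSetting.mkOfConnectedTemperoid X tf hZ hP NH A₀ hA₀ hA₀').biratUnits
    (BiKummerSetting.mkOfConnectedTemperoid X tf hZ hP NH A₀ hA₀ hA₀').Aodot}
  {Bl : (BiKummerSetting.mkOfConnectedTemperoid X tf hZ hP NH A₀ hA₀ hA₀').C}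
  {Pl : (BiKummerSetting.mkOfConnectedTemperoid X tf hZ hP NH A₀ hA₀ hA₀').FractionPair θ Bl}
  {Rl : (BiKummerSetting.mkOfConnectedTemperoid X tf hZ hP NH A₀ hA₀ hA₀').NthRoot θ Pl lv pullFrac}
  (h : ModelFrobenioid.Hypotheses tf.divisorMonoid tf.ratFnFunctor)
  (Q : FrobenioidTheta.ThetaSubquotientStub.{w} (ConnectedPart (BTemp X.Pi))) (odd_l : Odd (lv : ℕ))
  (R : (BiKummerSetting.mkOfConnectedTemperoid X tf hZ hP NH A₀ hA₀ hA₀').NthRoot Rl.root Rl.pair N pullFrac)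
  (ιX : T.PiX ≃ₜ* X.Pi) (K' : Type w) [Field K'] (constEmb : K'ˣ →* tf.biratUnitsModel R.BN)
  (constEmb_injective : Function.Injective constEmb)
  (hinvc : ∀ g : Aut R.AN.base,
    pull tf.divisorMonoid g.hom (ModelFrobenioid.div R.pair.num) = ModelFrobenioid.div R.pair.num)
  (hinvp : ∀ y : T.PiX, y ∈ T.PiYdd →
    pull tf.divisorMonoid ((BiKummerSetting.mkOfConnectedTemperoid X tf hZ hP NH A₀ hA₀ hA₀').galoisSurj R.AN.base
      R.αData.isGalois (ιX y)).hom (ModelFrobenioid.div R.pair.den) = ModelFrobenioid.div R.pair.den)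

/-- **Prop. 4.3 (iii), second clause / Prop. 5.2 (iii), Frobenioid half, AT THE GENUINE §5 DATA over `B^temp(Π^tp_X)⁰`** — unconditional
given the [FrdI] Thm. 5.2 hypotheses `h` of the data: for `y ∈ Π^tp_Ÿ`, `s^⊓-gp_N(ρ y)` acts on the restricted root function
`g_B = f_N|_{B_N} ∈ O^×(B_N^birat) = B(B_N^bs)^×` (abc-iut-L2-t9's `restrictAlongModel`, `biratAutModel`) by the rational function of the
bi-Kummer difference `s^⊔-gp_N(ρ y)·s^⊓-gp_N(ρ y)⁻¹`: «the Kummer class … `κ_{f|_{B_N}}`» of `f_N|_{B_N}` IS the bi-Kummer class.  The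
dictionary laws are the model formulas (`coe_fracOfModel_mul_unit`, `coe_biratAutModel_eq_pull`, `coe_restrictAlongModel_apply`), the section
property is `baseMap_strvOfBiKummerData`.  [cite: MochizukiEtTh2009, Prop 4.3 (iii) p.317 (PDF p.91); Prop 5.2 (iii) p.324 (PDF p.98); §5 p.331 (PDF p.105)] -/
theorem biratAutModel_sgpCap_restrict_ofConnectedTemperoidData (y : T.PiX) (hy : y ∈ T.PiYdd) :
    ((tf.biratAutModel R.BN
        ((ofConnectedTemperoidData h Q odd_l R ιX K' constEmb constEmb_injective hinvc hinvp).sgpCap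
          ((ofConnectedTemperoidData h Q odd_l R ιX K' constEmb constEmb_injective hinvc hinvp).ρ y))
        (tf.restrictAlongModel R.pair.num R.pair.isPreStep_num R.root) : tf.biratUnitsModel R.BN) :
        tf.ratFnFunctor.obj (op R.BN.base)) =
      (ModelFrobenioid.unit
          (((ofConnectedTemperoidData h Q odd_l R ιX K' constEmb constEmb_injective hinvc hinvp).sgpCup
              ⟨(ofConnectedTemperoidData h Q odd_l R ιX K' constEmb constEmb_injective hinvc hinvp).ρ y,
                Subgroup.mem_map_of_mem _ hy⟩ *
            ((ofConnectedTemperoidData h Q odd_l R ιX K' constEmb constEmb_injective hinvc hinvp).sgpCap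
              ((ofConnectedTemperoidData h Q odd_l R ιX K' constEmb constEmb_injective hinvc hinvp).ρ y))⁻¹ : Aut R.BN).hom) :
          tf.ratFnFunctor.obj (op R.BN.base)) *
        ((tf.restrictAlongModel R.pair.num R.pair.isPreStep_num R.root : tf.biratUnitsModel R.BN) :
          tf.ratFnFunctor.obj (op R.BN.base)) :=
  toB_biratAut_sgpCap_restrict_ofBiKummerData h (fun _ => MonoidHom.id _) Q odd_l R ιX _ _ K' constEmb constEmb_injective _ _
    (baseMap_strvOfBiKummerData h R) (fun s' s'' _ _ _ => BiKummerSetting.coe_fracOfModel_mul_unit tf T₀.isUnit_BΛ s' s'')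
    (fun e x => BiKummerSetting.coe_biratAutModel_eq_pull tf e x)
    (fun s hs x => TemperedFrobenioid.coe_restrictAlongModel_apply tf s hs x) y hy

/-- The same with the bi-Kummer difference packaged as abc-iut-L2-t11's `diffCocycle H k ∈ μ_N(B_N)` (`Sec5EnvelopeTopology.lean`; the
membership proof `H.biKummerDifferenceMem` is the only use of `H : Facts`): **`s^⊓-gp_N(ρ k)·g_B = u_{d(k)}·g_B`** — the Kummer cocycle
`k ↦ (k·g_B)·g_B⁻¹` of the root function on `Π^tp_Ÿ` IS `d = diffCocycle H`.
[cite: MochizukiEtTh2009, Prop 5.2 (iii) p.324 (PDF p.98); Prop 4.3 (iii) p.317 (PDF p.91)] -/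
theorem unit_diffCocycle_mul_restrict_ofConnectedTemperoidData
    (H : (ofConnectedTemperoidData h Q odd_l R ιX K' constEmb constEmb_injective hinvc hinvp).Facts)
    (k : (ofConnectedTemperoidData h Q odd_l R ιX K' constEmb constEmb_injective hinvc hinvp).PiYdd) :
    ((tf.biratAutModel R.BN
        ((ofConnectedTemperoidData h Q odd_l R ιX K' constEmb constEmb_injective hinvc hinvp).sgpCap
          ((ofConnectedTemperoidData h Q odd_l R ιX K' constEmb constEmb_injective hinvc hinvp).ρ k))
        (tf.restrictAlongModel R.pair.num R.pair.isPreStep_num R.root) : tf.biratUnitsModel R.BN) :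
        tf.ratFnFunctor.obj (op R.BN.base)) =
      (ModelFrobenioid.unit
          (((ofConnectedTemperoidData h Q odd_l R ιX K' constEmb constEmb_injective hinvc hinvp).diffCocycle H k :
            (ofConnectedTemperoidData h Q odd_l R ιX K' constEmb constEmb_injective hinvc hinvp).muTorsion
              (ofConnectedTemperoidData h Q odd_l R ιX K' constEmb constEmb_injective hinvc hinvp).BN N).1.hom) :
          tf.ratFnFunctor.obj (op R.BN.base)) *
        ((tf.restrictAlongModel R.pair.num R.pair.isPreStep_num R.root : tf.biratUnitsModel R.BN) :
          tf.ratFnFunctor.obj (op R.BN.base)) := by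
  have hd := (ofConnectedTemperoidData h Q odd_l R ιX K' constEmb constEmb_injective hinvc hinvp).coe_diffCocycle_eq H k
  have e := biratAutModel_sgpCap_restrict_ofConnectedTemperoidData h Q odd_l R ιX K' constEmb constEmb_injective hinvc hinvp k.1 k.2
  rw [hd]
  exact e

/-- **Uniqueness at the genuine data**: a unit `ζ ∈ O^×(B_N)` with `s^⊓-gp_N(ρ y)·g_B = u_ζ·g_B` IS `s^⊔-gp_N(ρ y)·s^⊓-gp_N(ρ y)⁻¹` — the root
function DETERMINES the bi-Kummer difference cocycle (`B(B_N^bs)` cancellative, `O^×(B_N) ↪ B(B_N^bs)` injective: `Φ` divisorial).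
[cite: MochizukiEtTh2009, Prop 4.3 (iii) p.317 (PDF p.91); §5 p.331 (PDF p.105)] -/
theorem eq_sgpCup_mul_sgpCap_inv_of_mul_restrict_ofConnectedTemperoidData (y : T.PiX) (hy : y ∈ T.PiYdd) (ζ : Aut R.BN)
    (hζ : ζ ∈ (ofConnectedTemperoidData h Q odd_l R ιX K' constEmb constEmb_injective hinvc hinvp).units
      (ofConnectedTemperoidData h Q odd_l R ιX K' constEmb constEmb_injective hinvc hinvp).BN)
    (e : ((tf.biratAutModel R.BN
        ((ofConnectedTemperoidData h Q odd_l R ιX K' constEmb constEmb_injective hinvc hinvp).sgpCap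
          ((ofConnectedTemperoidData h Q odd_l R ιX K' constEmb constEmb_injective hinvc hinvp).ρ y))
        (tf.restrictAlongModel R.pair.num R.pair.isPreStep_num R.root) : tf.biratUnitsModel R.BN) :
        tf.ratFnFunctor.obj (op R.BN.base)) =
      (ModelFrobenioid.unit ζ.hom : tf.ratFnFunctor.obj (op R.BN.base)) *
        ((tf.restrictAlongModel R.pair.num R.pair.isPreStep_num R.root : tf.biratUnitsModel R.BN) :
          tf.ratFnFunctor.obj (op R.BN.base))) :
    ζ = (ofConnectedTemperoidData h Q odd_l R ιX K' constEmb constEmb_injective hinvc hinvp).sgpCup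
          ⟨(ofConnectedTemperoidData h Q odd_l R ιX K' constEmb constEmb_injective hinvc hinvp).ρ y, Subgroup.mem_map_of_mem _ hy⟩ *
        ((ofConnectedTemperoidData h Q odd_l R ιX K' constEmb constEmb_injective hinvc hinvp).sgpCap
          ((ofConnectedTemperoidData h Q odd_l R ιX K' constEmb constEmb_injective hinvc hinvp).ρ y))⁻¹ := by
  haveI : IsCancelMul (tf.ratFnFunctor.obj (op R.BN.base)) :=
    isIntegral_iff_isCancelMul.mp (h.isGroupLike_rat R.BN.base).isPreDivisorial.isIntegral
  have hω : (ofConnectedTemperoidData h Q odd_l R ιX K' constEmb constEmb_injective hinvc hinvp).sgpCup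
        ⟨(ofConnectedTemperoidData h Q odd_l R ιX K' constEmb constEmb_injective hinvc hinvp).ρ y, Subgroup.mem_map_of_mem _ hy⟩ *
      ((ofConnectedTemperoidData h Q odd_l R ιX K' constEmb constEmb_injective hinvc hinvp).sgpCap
        ((ofConnectedTemperoidData h Q odd_l R ιX K' constEmb constEmb_injective hinvc hinvp).ρ y))⁻¹ ∈
      (ofConnectedTemperoidData h Q odd_l R ιX K' constEmb constEmb_injective hinvc hinvp).units
        (ofConnectedTemperoidData h Q odd_l R ιX K' constEmb constEmb_injective hinvc hinvp).BN :=
    sgpCup_mul_sgpCap_inv_mem_units _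
      (sgpCapSection_ofConnectedTemperoidData h Q odd_l R ιX K' constEmb constEmb_injective hinvc hinvp)
      (sgpCupSection_ofBiKummerData h _ Q odd_l R ιX _ _ K' constEmb constEmb_injective _ _ (baseMap_strvOfBiKummerData h R)) _
  rw [biratAutModel_sgpCap_restrict_ofConnectedTemperoidData h Q odd_l R ιX K' constEmb constEmb_injective hinvc hinvp y hy] at e
  have hu := (mul_right_cancel e).symm
  have key : ModelFrobenioid.unitsToRatFn R.BN ⟨ζ, hζ⟩ = ModelFrobenioid.unitsToRatFn R.BN ⟨_, hω⟩ := Units.ext hu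
  exact congrArg Subtype.val (ModelFrobenioid.unitsToRatFn_injective (h.isDivisorial R.BN.base).isPreDivisorial.isIntegral key)

/-! ### Prop. 5.2 (iii) ⟺ a clause on the root function alone -/

/-- **[EtTh] Prop. 5.2 (iii) AT THE GENUINE DATA ⟺ A CLAUSE ON THE ROOT FUNCTION `g_B = f_N|_{B_N}` ALONE.**  abc-iut-L2-t11's dictionary
F-0521 `ThetaSectionCompat H T′ ι m hYdd η` («the bi-Kummer difference cocycle, read through `m`, IS `η⁻¹`», Prop. 5.2 (iii) p.324 «relative to
the natural isomorphism between "`μ_N(−)`" and `(l·Δ_Θ) ⊗ ℤ/Nℤ`») holds IFF «for every `k ∈ Π^tp_Ÿ`, `s^⊓-gp_N(ρ k)·g_B = u_{m⁻¹(η(ι k))⁻¹}·g_B`»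
— the Kummer cocycle of the ROOT FUNCTION under the Galois action through `s^⊓-gp_N`, read through `m`, is `η⁻¹` (print's «Frobenioid-
theoretic version of … an `l`-th root of the theta function», Prop. 5.2 (i)).  With `η ∈ T′.thetaCocycles` this is the junction «`θ := Θ̈`»
(GAP G-L2t4-2) in Kummer currency — the honest residual of (iii).  [cite: MochizukiEtTh2009, Prop 5.2 (iii) p.324 (PDF p.98); Prop 5.2 (i) p.324 (PDF p.98)] -/
theorem thetaSectionCompat_iff_rootKummer_ofConnectedTemperoidData
    (H : (ofConnectedTemperoidData h Q odd_l R ιX K' constEmb constEmb_injective hinvc hinvp).Facts)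
    (T' : ThetaEnvData.{max u₀ w} N)
    (ι : (ofConnectedTemperoidData h Q odd_l R ιX K' constEmb constEmb_injective hinvc hinvp).PiX ≃* T'.PiX)
    (m : (ofConnectedTemperoidData h Q odd_l R ιX K' constEmb constEmb_injective hinvc hinvp).muTorsion
      (ofConnectedTemperoidData h Q odd_l R ιX K' constEmb constEmb_injective hinvc hinvp).BN N ≃* T'.mu)
    (hYdd : (ofConnectedTemperoidData h Q odd_l R ιX K' constEmb constEmb_injective hinvc hinvp).IdentifiesPiYdd T' ι)
    (η : T'.PiYdd → T'.mu) :
    (ofConnectedTemperoidData h Q odd_l R ιX K' constEmb constEmb_injective hinvc hinvp).ThetaSectionCompat H T' ι m hYdd η ↔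
      ∀ k : (ofConnectedTemperoidData h Q odd_l R ιX K' constEmb constEmb_injective hinvc hinvp).PiYdd,
        ((tf.biratAutModel R.BN
            ((ofConnectedTemperoidData h Q odd_l R ιX K' constEmb constEmb_injective hinvc hinvp).sgpCap
              ((ofConnectedTemperoidData h Q odd_l R ιX K' constEmb constEmb_injective hinvc hinvp).ρ k))
            (tf.restrictAlongModel R.pair.num R.pair.isPreStep_num R.root) : tf.biratUnitsModel R.BN) :
            tf.ratFnFunctor.obj (op R.BN.base)) =
          (ModelFrobenioid.unit
              (((m.symm (η ⟨ι k, (hYdd k).mp k.2⟩))⁻¹ :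
                (ofConnectedTemperoidData h Q odd_l R ιX K' constEmb constEmb_injective hinvc hinvp).muTorsion
                  (ofConnectedTemperoidData h Q odd_l R ιX K' constEmb constEmb_injective hinvc hinvp).BN N).1.hom) :
              tf.ratFnFunctor.obj (op R.BN.base)) *
            ((tf.restrictAlongModel R.pair.num R.pair.isPreStep_num R.root : tf.biratUnitsModel R.BN) :
              tf.ratFnFunctor.obj (op R.BN.base)) := by
  rw [(ofConnectedTemperoidData h Q odd_l R ιX K' constEmb constEmb_injective hinvc hinvp).thetaSectionCompat_iff_forall_coe]
  refine forall_congr' fun k => ⟨fun hk => ?_, fun hk => ?_⟩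
  · have e := biratAutModel_sgpCap_restrict_ofConnectedTemperoidData h Q odd_l R ιX K' constEmb constEmb_injective hinvc hinvp
      k.1 k.2
    refine e.trans ?_
    congr 2
    exact congrArg Iso.hom hk.symm
  · exact eq_sgpCup_mul_sgpCap_inv_of_mul_restrict_ofConnectedTemperoidData h Q odd_l R ιX K' constEmb constEmb_injective hinvc hinvp
      k.1 k.2 _ ((ofConnectedTemperoidData h Q odd_l R ιX K' constEmb constEmb_injective hinvc hinvp).muTorsion_le_units _ _
        ((m.symm (η ⟨ι k, (hYdd k).mp k.2⟩))⁻¹).2) hk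

end Genuine

end ThetaFrobenioid

end Literature.AnabelianGeometry.EtaleTheta

end
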